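import Literature.AnabelianGeometry.SemiGraphs.PSCUnrVerticialSeparatingCoveringsTwoComponentAffine
import Literature.AnabelianGeometry.SemiGraphs.PSCSeparatingCoveringsProofs2
import Literature.GroupTheory.CombinatorialGroupTheory.PuncturedSurfaceGroupIrrNodalUnrQuotientCoprod
import HarnessLib

/-!
# [CombGC] Prop. 1.2, proof p. 9: the `Π^unr`-VERTICIAL separating coverings at IRREDUCIBLE ONE-NODAL data (stratum `Δ_irr`), and the sturdy `Π^unr`-clauses of Prop. 1.2 (i)(ii) there

Mochizuki, *A combinatorial version of the Grothendieck conjecture*, Tohoku Math. J. **59** (2007)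
[CombGC], PROOF of Prop. 1.2, p. 9 (the `Π^unr`-separating coverings) [cite: MochizukiCombGC2007, Prop 1.2 proof p.9]
and Prop. 1.2 (i)(ii) p. 8, unramified clauses [cite: MochizukiCombGC2007, Prop 1.2 pp.8-9].  Typed LEVEL-WISE
by abc-iut-w4-d081 (`PSCDatum.UnrVerticialSeparatingCoverings`, row P12-L01-U, FACT row F-2828) and by
abc-iut-L3-t4 (`UnrVerticialOpenInterDeterminesVertex`, `UnrVerticialCommensurablyTerminal`: the
`Π^unr`-clauses of F-0459 / F-0438); universal closures refuted, instance forms at genuine carriers the content.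

PROOF-ONLY file (abc-iut-f-164 gen 4): the instance at the IRREDUCIBLE ONE-NODAL shape of gen 2
(`PSCIrreducibleNodalOrigin.lean`: an irreducible pointed stable curve with ONE node, geometric genus `g − 1`,
`r` marked points; dual semi-graph = ONE vertex with a LOOP — the first datum of the `Π^unr` programme whose
dual graph is NOT a tree; `ι : Γ_{g,r} → Π` a profinite pro-`Σ` completion of the smoothing, node group
`cl ι⟨b_0⟩`, vertex group `cl ι⟨b_0, a_0 b_0 a_0⁻¹, a_i, b_i (i ≥ 1), c_j⟩`).  Here
`Π^unr ≅ (Γ_{g−1,0} ∗ ℤ)^Σ` has a genuine free procyclic factor (the stable letter `a_0`, i.e. the loop of the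
dual graph), and the unramified verticial subgroup is the image of the FIRST factor
(`PuncturedSurfaceGroupIrrNodalUnrQuotientCoprod`).  With ONE vertex only same-vertex pairs of level vertices
occur: abc-iut-f-166's fibred twist in `Γ_{g−1,0} ∗ ℤ` (`exists_normal_separating_sameFactor` of
abc-iut-w5-d047) and the transfer along the pro-`Σ` completion (`exists_open_unrSeparating_same`) give

* `unrVerticialSeparatingCoverings_of_irreducibleNodal` — **row P12-L01-U / F-2828 at EVERY irreducible
  one-nodal datum** (`V' := V`; sturdiness `g − 1 ≥ 2` enters through its own antecedent);
* `unrRows_of_irreducibleNodal` — with abc-iut-w5-d183's formal steps, BOTH sturdy `Π^unr`-clauses of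
  Prop. 1.2 (i)(ii) there (the (i)-clause is trivial at one vertex and was recorded by gen 2; the (ii)-clause —
  commensurable terminality of the image of `Π_v` in `Π^unr ≅ (Γ_{g−1,0} ∗ ℤ)^Σ` — is NEW);
* `irreducibleNodalOrigin_unrRows` — the same at every origin of such data (gen 2's origin hypothesis BY NAME).

HONEST SCOPE: the verticial/edge-like clause of Prop. 1.2 (ii) at this shape (the vertex group is NOT the
closure of a free factor) is not treated.  A shape instance is consistency evidence for the typed schemata,
not the printed statement for all pointed stable curves (cell FOUNDATIONS rows 13–14).  0 definitions; nothing
here takes a side on [IUTchIII] Cor. 3.12.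
-/

noncomputable section

open scoped Pointwise

/-! ### The vertex generating set read in `Γ_{g+1,r}/⟨⟨b_0, c_j⟩⟩ ≅ Γ_{g,0} ∗ ℤ` -/

namespace Literature.GroupTheory.CombinatorialGroupTheory.PuncturedSurfaceGroup

open Monoid (Coprod)

/-- In `Γ_{g+1,r}/K` (`b_0, c_j ∈ K`) the vertex generating set of the irreducible one-nodal shape —
`b_0`, `a_0 b_0 a_0⁻¹`, the handles `i ≥ 1`, all cusps — generates the closed-surface factor: its image is the
range of any hom `Γ_{g,0} → Γ_{g+1,r}/K` pinned on the shifted handle letters.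
[cite: MochizukiCombGC2007, Def 1.1(ii) p.7] -/
theorem map_mk_closure_irrNodal_eq_range {g r : ℕ} {K : Subgroup (PuncturedSurfaceGroup (g + 1) r)}
    [K.Normal] (hbK : b (r := r) (0 : Fin (g + 1)) ∈ K) (hcK : ∀ j, c j ∈ K)
    (θ : PuncturedSurfaceGroup g 0 →* _ ⧸ K)
    (hpin : ∀ (j : Fin g) (bit : Bool), θ (PresentedGroup.of (Sum.inl (j, bit))) =
      QuotientGroup.mk (PresentedGroup.of (Sum.inl (Fin.succ j, bit)))) :
    (Subgroup.closure {x : PuncturedSurfaceGroup (g + 1) r |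
        x = b 0 ∨ x = a 0 * b 0 * (a 0)⁻¹ ∨
          (∃ i : Fin (g + 1), 1 ≤ (i : ℕ) ∧ (x = a i ∨ x = b i)) ∨ ∃ j : Fin r, x = c j}).map
      (QuotientGroup.mk' K) = θ.range := by
  rw [MonoidHom.range_eq_map, ← PresentedGroup.closure_range_of, MonoidHom.map_closure,
    MonoidHom.map_closure]
  apply le_antisymm
  · refine (Subgroup.closure_le _).mpr ?_
    rintro y ⟨x, hx, rfl⟩
    rcases hx with rfl | rfl | ⟨i, hi, rfl | rfl⟩ | ⟨j, rfl⟩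
    · rw [QuotientGroup.mk'_apply, (QuotientGroup.eq_one_iff _).mpr hbK]
      exact Subgroup.one_mem _
    · rw [QuotientGroup.mk'_apply, (QuotientGroup.eq_one_iff _).mpr
        (by simpa using (inferInstance : K.Normal).conj_mem _ hbK (a (r := r) (0 : Fin (g + 1))))]
      exact Subgroup.one_mem _
    · have hi' : (i : ℕ) - 1 < g := by omega
      have hii : i = Fin.succ ⟨(i : ℕ) - 1, hi'⟩ := Fin.ext (by simp only [Fin.val_succ]; omega)
      refine Subgroup.subset_closure ⟨a ⟨(i : ℕ) - 1, hi'⟩, ⟨Sum.inl (⟨(i : ℕ) - 1, hi'⟩, false), rfl⟩, ?_⟩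
      change θ (PresentedGroup.of (Sum.inl (⟨(i : ℕ) - 1, hi'⟩, false))) = _
      rw [hpin, QuotientGroup.mk'_apply]
      exact congrArg (fun t : Fin (g + 1) =>
        (QuotientGroup.mk (PresentedGroup.of (Sum.inl (t, false))) :
          PuncturedSurfaceGroup (g + 1) r ⧸ K)) hii.symm
    · have hi' : (i : ℕ) - 1 < g := by omega
      have hii : i = Fin.succ ⟨(i : ℕ) - 1, hi'⟩ := Fin.ext (by simp only [Fin.val_succ]; omega)
      refine Subgroup.subset_closure ⟨b ⟨(i : ℕ) - 1, hi'⟩, ⟨Sum.inl (⟨(i : ℕ) - 1, hi'⟩, true), rfl⟩, ?_⟩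
      change θ (PresentedGroup.of (Sum.inl (⟨(i : ℕ) - 1, hi'⟩, true))) = _
      rw [hpin, QuotientGroup.mk'_apply]
      exact congrArg (fun t : Fin (g + 1) =>
        (QuotientGroup.mk (PresentedGroup.of (Sum.inl (t, true))) :
          PuncturedSurfaceGroup (g + 1) r ⧸ K)) hii.symm
    · rw [QuotientGroup.mk'_apply, (QuotientGroup.eq_one_iff _).mpr (hcK j)]
      exact Subgroup.one_mem _
  · refine (Subgroup.closure_le _).mpr ?_
    rintro y ⟨z, ⟨x, rfl⟩, rfl⟩
    rcases x with ⟨j, bit⟩ | j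
    · refine Subgroup.subset_closure ⟨PresentedGroup.of (Sum.inl (Fin.succ j, bit)), ?_, ?_⟩
      · refine Or.inr (Or.inr (Or.inl ⟨Fin.succ j, by simp only [Fin.val_succ]; omega, ?_⟩))
        cases bit
        · exact Or.inl rfl
        · exact Or.inr rfl
      · rw [QuotientGroup.mk'_apply, ← hpin j bit]
    · exact Fin.elim0 j

end Literature.GroupTheory.CombinatorialGroupTheory.PuncturedSurfaceGroup

namespace Literature.AnabelianGeometry.SemiGraphs

namespace PSCDatum

open Literature.AnabelianGeometry.Anabelioids (IsSigmaInteger)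
open Literature.GroupTheory.CombinatorialGroupTheory
open Monoid (Coprod)
open SemiGraphOfAnabelioids (IsProSigmaCompletion)
open SemiGraphOfAnabelioids.IsProSigmaCompletion (exists_open_unrSeparating_same finiteIndex_comap)
open Literature.GroupTheory.CombinatorialGroupTheory.PuncturedSurfaceGroup (a b c cuspInertia
  exists_mulEquiv_irrNodalUnrQuotient_coprod map_mk_closure_irrNodal_eq_range exists_handleCharacter_pow_ne_one)

variable {P : Type} [Group P] [TopologicalSpace P] [IsTopologicalGroup P]
variable [CompactSpace P] [TotallyDisconnectedSpace P] {Sigma : Set ℕ} {g r : ℕ}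

/-- **Row P12-L01-U (`UnrVerticialSeparatingCoverings`, F-2828) at the genuine IRREDUCIBLE ONE-NODAL data**
(one vertex with a loop; `V' := V`): two DISTINCT level-`V` vertices `(v₀, Vγ₁(Π_{v₀}·Ker)) ≠ (v₀, Vγ₂(Π_{v₀}·Ker))`
are separated by an open `U ≤ V`, normal in `V`, with `(γ₂Π_{v₀}γ₂⁻¹ · Ker) ∩ V ≤ U` and `γ₁Π_{v₀}γ₁⁻¹ ∩ V ⊄ U`
— the fibred twist in `Γ_{g,r}/⟨⟨b_0, c_j⟩⟩ ≅ Γ_{g−1,0} ∗ ℤ` transferred along the pro-`Σ` completion; witness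
`a_1^{[Γ:ι⁻¹V]}`.  Sturdiness (`g − 1 ≥ 2`) enters through its own antecedent.
[cite: MochizukiCombGC2007, Prop 1.2 proof p.9] -/
theorem unrVerticialSeparatingCoverings_of_irreducibleNodal (hne : Sigma.Nonempty)
    (hprime : ∀ p ∈ Sigma, p.Prime) (ι : PuncturedSurfaceGroup g r →* P)
    (hι : IsProSigmaCompletion Sigma ι) (G : PSCDatum P) (hg : 1 ≤ g) (e : G.graph.C ≃ Fin r)
    (hC : ∀ c', G.cuspGp c' = ((cuspInertia (g := g) (e c')).map ι).topologicalClosure)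
    (v₀ : G.graph.V) (hV : ∀ w, w = v₀) (n₀ : G.graph.N) (hN : ∀ n, n = n₀)
    (hE : G.nodeGp n₀ = ((Subgroup.zpowers (PuncturedSurfaceGroup.b (r := r) (⟨0, hg⟩ : Fin g))).map
      ι).topologicalClosure)
    (hV₀ : G.vertGp v₀ = ((Subgroup.closure {x : PuncturedSurfaceGroup g r |
        x = PuncturedSurfaceGroup.b ⟨0, hg⟩ ∨
        x = PuncturedSurfaceGroup.a ⟨0, hg⟩ * PuncturedSurfaceGroup.b ⟨0, hg⟩ * (PuncturedSurfaceGroup.a ⟨0, hg⟩)⁻¹ ∨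
        (∃ i : Fin g, 1 ≤ (i : ℕ) ∧ (x = PuncturedSurfaceGroup.a i ∨ x = PuncturedSurfaceGroup.b i)) ∨
        ∃ j : Fin r, x = PuncturedSurfaceGroup.c j}).map ι).topologicalClosure)
    (hgen : G.genus v₀ = g - 1) :
    G.UnrVerticialSeparatingCoverings := by
  classical
  intro hst V hVn hVo
  haveI := hVn
  have h2 : 2 ≤ g - 1 := hgen ▸ hst v₀
  obtain ⟨g', rfl⟩ : ∃ g', g = g' + 1 := ⟨g - 1, by omega⟩
  have hg' : 2 ≤ g' := by omega
  have h0 : (⟨0, hg⟩ : Fin (g' + 1)) = 0 := rfl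
  simp only [h0] at hE hV₀
  obtain ⟨ℓ, hℓS⟩ := hne
  have hℓ : ℓ.Prime := hprime ℓ hℓS
  set K : Subgroup (PuncturedSurfaceGroup (g' + 1) r) :=
    Subgroup.normalClosure ({b (r := r) (0 : Fin (g' + 1))} ∪
      Set.range (c : Fin r → PuncturedSurfaceGroup (g' + 1) r)) with hKdef
  have hcK : ∀ j, c j ∈ K := fun j => Subgroup.subset_normalClosure (Or.inr ⟨j, rfl⟩)
  have hbK : b (r := r) (0 : Fin (g' + 1)) ∈ K := Subgroup.subset_normalClosure (Or.inl rfl)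
  have hKer : G.unrKer = (K.map ι).topologicalClosure := by
    let xs : G.graph.N ⊕ G.graph.C → PuncturedSurfaceGroup (g' + 1) r :=
      Sum.elim (fun _ => b 0) fun c' => c (e c')
    have hx : ∀ e', G.edgeGp e' = ((Subgroup.zpowers (xs e')).map ι).topologicalClosure := by
      rintro (n | c')
      · change G.nodeGp n = ((Subgroup.zpowers (b 0)).map ι).topologicalClosure
        rw [hN n, hE]
      · exact hC c'
    have hrange : Set.range xs = {b (r := r) (0 : Fin (g' + 1))} ∪
        Set.range (c : Fin r → PuncturedSurfaceGroup (g' + 1) r) := by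
      ext x
      simp only [xs, Set.mem_range, Set.mem_union, Set.mem_singleton_iff, Sum.exists, Sum.elim_inl,
        Sum.elim_inr]
      constructor
      · rintro (⟨_, rfl⟩ | ⟨c', rfl⟩)
        · exact Or.inl rfl
        · exact Or.inr ⟨e c', rfl⟩
      · rintro (rfl | ⟨j, rfl⟩)
        · exact Or.inl ⟨n₀, rfl⟩
        · exact Or.inr ⟨e.symm j, by rw [Equiv.apply_symm_apply]⟩
    rw [G.unrKer_eq_topologicalClosure_map_normalClosure hι.dense xs hx, hrange]
  -- the Tietze datum `Γ/K ≅ Γ_{g',0} ∗ ℤ` and the image of the vertex generating set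
  obtain ⟨_, eT, heT, -⟩ := exists_mulEquiv_irrNodalUnrQuotient_coprod g' r
  have hpin : ∀ (j : Fin g') (bit : Bool), eT.symm (Coprod.inl (PresentedGroup.of (Sum.inl (j, bit)))) =
      QuotientGroup.mk (PresentedGroup.of (Sum.inl (Fin.succ j, bit))) :=
    fun j bit => (MulEquiv.symm_apply_eq eT).mpr (heT j bit).symm
  set H : Subgroup (PuncturedSurfaceGroup (g' + 1) r) := Subgroup.closure {x : PuncturedSurfaceGroup (g' + 1) r |
      x = b 0 ∨ x = a 0 * b 0 * (a 0)⁻¹ ∨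
        (∃ i : Fin (g' + 1), 1 ≤ (i : ℕ) ∧ (x = a i ∨ x = b i)) ∨ ∃ j : Fin r, x = c j} with hHdef
  have hHA : H.map (QuotientGroup.mk' K) = (eT.symm.toMonoidHom.comp Coprod.inl).range :=
    map_mk_closure_irrNodal_eq_range hbK hcK _ fun j bit => hpin j bit
  -- the level `N = ι⁻¹(V)` and the witness `a_1^m`
  haveI hNfi : (V.comap ι).FiniteIndex := finiteIndex_comap hι V hVo
  have hm : 0 < (V.comap ι).index := Nat.pos_of_ne_zero Subgroup.FiniteIndex.index_ne_zero
  haveI : NeZero (ℓ ^ (V.comap ι).index) := ⟨(pow_pos hℓ.pos _).ne'⟩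
  have hnm : ¬ ℓ ^ (V.comap ι).index ∣ (V.comap ι).index := fun h =>
    absurd (Nat.le_of_dvd hm h) (not_le.mpr (Nat.lt_pow_self hℓ.one_lt))
  obtain ⟨ψ, hψ, hcard⟩ := exists_handleCharacter_pow_ne_one (g := g') (by omega) (V.comap ι).index
    (ℓ ^ (V.comap ι).index) hnm
  have ha₁N : a (r := r) (Fin.succ (⟨0, by omega⟩ : Fin g')) ^ (V.comap ι).index ∈ V.comap ι :=
    (V.comap ι).pow_index_mem _
  have ha₁H : a (r := r) (Fin.succ (⟨0, by omega⟩ : Fin g')) ^ (V.comap ι).index ∈ H :=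
    H.pow_mem (Subgroup.subset_closure (Or.inr (Or.inr (Or.inl ⟨Fin.succ ⟨0, by omega⟩,
      by simp only [Fin.val_succ]; omega, Or.inl rfl⟩)))) _
  have hα : QuotientGroup.mk' K (a (r := r) (Fin.succ (⟨0, by omega⟩ : Fin g')) ^ (V.comap ι).index) =
      eT.symm (Coprod.inl (a ⟨0, by omega⟩ ^ (V.comap ι).index)) := by
    rw [map_pow, map_pow, map_pow, QuotientGroup.mk'_apply]
    exact congrArg (· ^ (V.comap ι).index) (hpin ⟨0, by omega⟩ false).symm
  have hS : ∀ U' : Subgroup (V.comap ι), U'.index ∣ Nat.card (Multiplicative (ZMod (ℓ ^ (V.comap ι).index))) →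
      U'.FiniteIndex → IsSigmaInteger Sigma U'.index := fun U' h hf =>
    ⟨Nat.pos_of_ne_zero hf.index_ne_zero, fun _ hp hpn =>
      ((Nat.prime_dvd_prime_iff_eq hp hℓ).mp (hp.dvd_of_dvd_pow (hpn.trans (hcard ▸ h)))) ▸ hℓS⟩
  refine ⟨V, hVn, hVo, le_rfl, fun w₁ w₂ γ₁ γ₂ hdc => ?_⟩
  obtain rfl := hV w₁
  obtain rfl := hV w₂
  refine exists_open_unrSeparating_same hι H K _ _ hV₀ hKer V hVo γ₁ γ₂
    (hdc.resolve_left fun h => h rfl) fun f₁ f₂ hf => ?_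
  obtain ⟨U', hU'n, hidx, hfi, hnot, hle⟩ :=
    exists_normal_separating_sameFactor K eT.symm H hHA (V.comap ι) ψ ha₁N hα hψ hf
  refine ⟨U', hU'n, hS U' hidx hfi, hle, _, ⟨?_, (inferInstance : (V.comap ι).Normal).conj_mem _ ha₁N f₁⟩,
    hnot⟩
  have hfx : f₁ * a (r := r) (Fin.succ (⟨0, by omega⟩ : Fin g')) ^ (V.comap ι).index * f₁⁻¹ =
      ConjAct.toConjAct f₁ • (a (r := r) (Fin.succ (⟨0, by omega⟩ : Fin g')) ^ (V.comap ι).index) := by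
    rw [ConjAct.smul_def, ConjAct.ofConjAct_toConjAct]
  rw [hfx]
  exact Subgroup.smul_mem_pointwise_smul _ _ _ ha₁H

/-- **F-2828 and the sturdy `Π^unr`-clauses of [CombGC] Prop. 1.2 (i)(ii) at every irreducible one-nodal
datum**: `UnrVerticialSeparatingCoverings ∧ UnrVerticialOpenInterDeterminesVertex ∧
UnrVerticialCommensurablyTerminal` — the last = commensurable terminality of the image of `Π_v` in
`Π^unr ≅ (Γ_{g−1,0} ∗ ℤ)^Σ` for `g − 1 ≥ 2` (NEW), by abc-iut-w5-d183's formal steps.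
[cite: MochizukiCombGC2007, Prop 1.2 pp.8-9] -/
theorem unrRows_of_irreducibleNodal (hne : Sigma.Nonempty)
    (hprime : ∀ p ∈ Sigma, p.Prime) (ι : PuncturedSurfaceGroup g r →* P)
    (hι : IsProSigmaCompletion Sigma ι) (G : PSCDatum P) (hg : 1 ≤ g) (e : G.graph.C ≃ Fin r)
    (hC : ∀ c', G.cuspGp c' = ((cuspInertia (g := g) (e c')).map ι).topologicalClosure)
    (v₀ : G.graph.V) (hV : ∀ w, w = v₀) (n₀ : G.graph.N) (hN : ∀ n, n = n₀)
    (hE : G.nodeGp n₀ = ((Subgroup.zpowers (PuncturedSurfaceGroup.b (r := r) (⟨0, hg⟩ : Fin g))).map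
      ι).topologicalClosure)
    (hV₀ : G.vertGp v₀ = ((Subgroup.closure {x : PuncturedSurfaceGroup g r |
        x = PuncturedSurfaceGroup.b ⟨0, hg⟩ ∨
        x = PuncturedSurfaceGroup.a ⟨0, hg⟩ * PuncturedSurfaceGroup.b ⟨0, hg⟩ * (PuncturedSurfaceGroup.a ⟨0, hg⟩)⁻¹ ∨
        (∃ i : Fin g, 1 ≤ (i : ℕ) ∧ (x = PuncturedSurfaceGroup.a i ∨ x = PuncturedSurfaceGroup.b i)) ∨
        ∃ j : Fin r, x = PuncturedSurfaceGroup.c j}).map ι).topologicalClosure)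
    (hgen : G.genus v₀ = g - 1) :
    G.UnrVerticialSeparatingCoverings ∧ G.UnrVerticialOpenInterDeterminesVertex ∧
      G.UnrVerticialCommensurablyTerminal :=
  have hU := G.unrVerticialSeparatingCoverings_of_irreducibleNodal hne hprime ι hι hg e hC v₀ hV n₀ hN hE hV₀ hgen
  ⟨hU, G.unrVerticialOpenInterDeterminesVertex_of_separating hU,
    G.unrVerticialCommensurablyTerminal_of_separating hU⟩

/-! ### Origin level -/

/-- **F-2828 and both sturdy `Π^unr`-clauses of Prop. 1.2 (i)(ii), datum-wise, at EVERY origin whose data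
are of irreducible one-nodal shape** (gen 2's origin hypothesis of `PSCIrreducibleNodalOrigin.lean` BY NAME;
profinite `Π` in `Type`). [cite: MochizukiCombGC2007, Prop 1.2 pp.8-9] -/
theorem irreducibleNodalOrigin_unrRows (Ω : PSCOrigin.{0})
    (hΩ : ∀ ⦃Q : Type⦄ [Group Q] [TopologicalSpace Q] [IsTopologicalGroup Q] (G : PSCDatum Q),
      Ω.IsOfPSCType G → CompactSpace Q ∧ T2Space Q ∧ TotallyDisconnectedSpace Q ∧
        ∃ (S : Set ℕ) (g r : ℕ) (hg : 1 ≤ g) (ι : PuncturedSurfaceGroup g r →* Q) (e : G.graph.C ≃ Fin r)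
          (v₀ : G.graph.V) (n₀ : G.graph.N),
          S.Nonempty ∧ (∀ p ∈ S, p.Prime) ∧ IsProSigmaCompletion S ι ∧ (2 ≤ g ∨ 2 ≤ r) ∧
          (∀ c, G.cuspGp c =
            ((PuncturedSurfaceGroup.cuspInertia (g := g) (e c)).map ι).topologicalClosure) ∧
          (∀ w, w = v₀) ∧ (∀ n, n = n₀) ∧
          G.nodeGp n₀ = ((Subgroup.zpowers (PuncturedSurfaceGroup.b (r := r) (⟨0, hg⟩ : Fin g))).map
            ι).topologicalClosure ∧
          G.vertGp v₀ = ((Subgroup.closure {x : PuncturedSurfaceGroup g r |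
            x = PuncturedSurfaceGroup.b ⟨0, hg⟩ ∨
            x = PuncturedSurfaceGroup.a ⟨0, hg⟩ * PuncturedSurfaceGroup.b ⟨0, hg⟩ * (PuncturedSurfaceGroup.a ⟨0, hg⟩)⁻¹ ∨
            (∃ i : Fin g, 1 ≤ (i : ℕ) ∧ (x = PuncturedSurfaceGroup.a i ∨ x = PuncturedSurfaceGroup.b i)) ∨
            ∃ j : Fin r, x = PuncturedSurfaceGroup.c j}).map ι).topologicalClosure ∧
          G.genus v₀ = g - 1) :
    ∀ ⦃Q : Type⦄ [Group Q] [TopologicalSpace Q] [IsTopologicalGroup Q] (G : PSCDatum Q),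
      Ω.IsOfPSCType G → G.UnrVerticialSeparatingCoverings ∧ G.UnrVerticialOpenInterDeterminesVertex ∧
        G.UnrVerticialCommensurablyTerminal := by
  intro Q _ _ _ G hG
  obtain ⟨hc, -, hd, S, g, r, hg, ι, e, v₀, n₀, hne, hprime, hι, -, hC, hV, hN, hE, hV₀, hgen⟩ := hΩ G hG
  haveI := hc
  haveI := hd
  exact G.unrRows_of_irreducibleNodal hne hprime ι hι hg e hC v₀ hV n₀ hN hE hV₀ hgen

end PSCDatum

end Literature.AnabelianGeometry.SemiGraphs

end
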